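import Summits.CriticalPhenomena.PercolationContinuityZ3.Theorems.FK.InfiniteVolumeDLR
import Summits.CriticalPhenomena.PercolationContinuityZ3.Theorems.FK.InfiniteVolumeCylinders
import Summits.CriticalPhenomena.PercolationContinuityZ3.Theorems.FK.InfiniteVolumeInvariance
import Summits.CriticalPhenomena.PercolationContinuityZ3.Theorems.FK.InfiniteVolumeMeasures
import HarnessLib

/-!
# FK-continuity transplant, FO-06 (interface half): mixing on local events and ergodicity of the box limits
# `φ⁰_{p,q}`, `φ¹_{p,q}` under translations (Grimmett 2006, Thm. (4.19)(d), Cor. (4.23))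

Cell `fk-continuity` (bschramm), row FO-06a-3; support file for the FK-continuity transplant
(`--supports stmt-CriticalPhenomena-4575`); builds on p205010 (kernel theorem, internal audit signed; external expert
review pending).  Pure proofs; no definitions, no named facts, no sorries.  The main theorems take translation
INVARIANCE as a hypothesis `MeasurePreserving (BondConfig.relabel (sym2Equiv (Site.shift v))) P P` (Grimmett 2006,
Thm. (4.19)(b)); it is discharged by the cell's `InfiniteVolumeInvariance.lean` (seat B) in the closing corollaries
`IsBoxLimit.ergodic_shift'`, `IsBoxLimit.zero_one'`, `ergodic_shift_rcLimit` (unconditional).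

* `IsBoxLimit.abs_real_inter_sub_mul_le` — the KEY ESTIMATE (Grimmett's proof of Thm. (4.19)(d), p. 79, in
  sandwich form): `|P(A ∩ C) - P(A) P(C)| ≤ |φ^b_{Λ_m,p,q}(A) - P(A)|` for `A` increasing determined by `E_{Λ_m}` and
  `C` determined by finitely many pairs off `E_{Λ_m}`; translates of local events are local with determining sets
  eventually off any box (`determinedBy_preimage_relabel(_iterate)`, `eventually_disjoint_map_shift_pow`).
* `IsBoxLimit.tendsto_real_setOf_subset_inter_preimage_iterate` (increasing cylinders) and
  `IsBoxLimit.tendsto_real_inter_preimage_iterate` — **mixing on all local events**, `P(A ∩ τ_v^{-n} B) → P(A) P(B)`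
  (via the conditional measures `P(· | τ_v^{-n} B)` and the cell's `exists_measure_tendsto_of_tendsto_supset` /
  `ext_of_setOf_subset`; Grimmett 2006, Cor. (4.23)); `IsBoxLimit.ergodic_shift` — **ergodic under every non-zero
  translation** (tree: `ergodic_relabel_of_asymptotic_mixing_isLocalEvent`); `IsBoxLimit.zero_one` — the `zero_one`
  field of the tree's `IsInsertionTolerantErgodic` (`d ≥ 1`).

## References

* G. Grimmett, *The Random-Cluster Model*, Springer 2006: §4.3 Thm. (4.19)(b),(d) and its proof (p. 79),
  (4.22), Cor. (4.23). [Grimmett2006]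
* G. Grimmett, *Percolation*, 2nd ed., Springer 1999, §2.2 (local events). [GrimmettPercolation1999]
-/

noncomputable section

open MeasureTheory Set Filter
open scoped Topology ENNReal

namespace Summit.CriticalPhenomena.PercolationContinuityZ3.Theorems.FK

open Literature.Probability.Percolation Literature.Probability.LatticeModels

/-! ## Mixing on local events and ergodicity under translations (Grimmett 2006, Thm. (4.19)(d), Cor. (4.23)) -/

section Ergodic

open Finset

variable {d : ℕ} {b : Bool} {p q : ℝ} {P : Measure (BondConfig (Site d))}

/-- **The key estimate**: `|P(A ∩ C) - P(A) P(C)| ≤ |φ^b_{Λ_m,p,q}(A) - P(A)|` for the box limit `P = φ^b_{p,q}`, `A`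
increasing determined by `E_{Λ_m}`, `C` determined by finitely many pairs off `E_{Λ_m}` (the sandwich applied to `C`
and to `Cᶜ`; free bound for `b = 0`, wired for `b = 1`). [cite: Grimmett2006, Thm. (4.19)(d) (proof, p. 79)] -/
theorem IsBoxLimit.abs_real_inter_sub_mul_le (hP : IsBoxLimit d b p q P) (hp : p ∈ Set.Icc (0 : ℝ) 1)
    (hq : 1 ≤ q) (m : ℕ) {A C : Set (BondConfig (Site d))} (T : Finset (Sym2 (Site d)))
    (hA : IsUpperSet A) (hAm : DeterminedBy A ↑(edgesIn (zdGraph d) (box d m)))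
    (hT : Disjoint (↑T : Set (Sym2 (Site d))) ↑(edgesIn (zdGraph d) (box d m))) (hC : DeterminedBy C ↑T) :
    |P.real (A ∩ C) - P.real A * P.real C| ≤ |(rcBoxLaw d b p q m).real A - P.real A| := by
  classical
  haveI := hP.isProbabilityMeasure
  have hAmeas : MeasurableSet A := measurableSet_of_isLocalEvent_holds ⟨_, hAm⟩
  have hCmeas : MeasurableSet C := measurableSet_of_isLocalEvent_holds ⟨T, hC⟩
  -- `Cᶜ` is determined by the same pairs
  have hCc : DeterminedBy Cᶜ ↑T := by
    rw [determinedBy_iff] at hC ⊢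
    exact fun ω ω' h => not_congr (hC ω ω' h)
  -- `P(A ∩ Cᶜ) = P(A) - P(A ∩ C)` and `P(Cᶜ) = 1 - P(C)`
  have hsplit : P.real (A ∩ C) + P.real (A ∩ Cᶜ) = P.real A := by
    have := measureReal_inter_add_sdiff (μ := P) (s := A) hCmeas
    rwa [Set.sdiff_eq_compl_inter, Set.inter_comm Cᶜ A] at this
  have hCc1 : P.real Cᶜ = 1 - P.real C := by rw [measureReal_compl hCmeas, probReal_univ]
  cases b with
  | false =>
    -- free limit: lower sandwich with the free box law, which is `regionFreeReal` of the box
    have h1 := hP.regionFreeReal_mul_le hp hq (box d m) T hA hAm hT hC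
    have h2 := hP.regionFreeReal_mul_le hp hq (box d m) T hA hAm hT hCc
    rw [regionFreeReal_box p q m hAmeas] at h1 h2
    rw [hCc1] at h2
    have h3 : (rcBoxLaw d false p q m).real A ≤ P.real A := by
      have := hP.regionFreeReal_mul_le hp hq (box d m) (H := Set.univ) ∅ hA hAm (by simp)
        ((determinedBy_iff _ _).2 fun _ _ _ => Iff.rfl)
      rw [regionFreeReal_box p q m hAmeas] at this
      simpa using this
    rw [abs_le, abs_of_nonpos (sub_nonpos.2 h3)]
    constructor
    · nlinarith [h1, measureReal_nonneg (μ := P) (s := C), measureReal_le_one (μ := P) (s := C)]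
    · nlinarith [h2, hsplit, measureReal_nonneg (μ := P) (s := C), measureReal_le_one (μ := P) (s := C)]
  | true =>
    have h1 := hP.le_regionWiredReal_mul hp hq (box d m) T hA hAm hT hC
    have h2 := hP.le_regionWiredReal_mul hp hq (box d m) T hA hAm hT hCc
    rw [regionWiredReal_box p q m hAmeas] at h1 h2
    rw [hCc1] at h2
    have h3 : P.real A ≤ (rcBoxLaw d true p q m).real A := by
      have := hP.le_regionWiredReal_mul hp hq (box d m) (H := Set.univ) ∅ hA hAm (by simp)
        ((determinedBy_iff _ _).2 fun _ _ _ => Iff.rfl)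
      rw [regionWiredReal_box p q m hAmeas] at this
      simpa using this
    rw [abs_le, abs_of_nonneg (sub_nonneg.2 h3)]
    constructor
    · nlinarith [h2, hsplit, measureReal_nonneg (μ := P) (s := C), measureReal_le_one (μ := P) (s := C)]
    · nlinarith [h1, measureReal_nonneg (μ := P) (s := C), measureReal_le_one (μ := P) (s := C)]

/-- Pulling back an event determined by `F` along the relabelling by a bijection `e` gives an event determined by
`e⁻¹(F)`. [cite: Grimmett2006, §4.3 (τ-invariance, p. 76)] -/
theorem determinedBy_preimage_relabel {ι : Type*} (e : ι ≃ ι) {B : Set (Set ι)} {F : Finset ι}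
    (hB : DeterminedBy B ↑F) : DeterminedBy (SiteConfig.relabel e ⁻¹' B) ↑(F.map e.symm.toEmbedding) := by
  rw [determinedBy_iff] at hB ⊢
  intro ω ω' h
  simp only [Set.mem_preimage, SiteConfig.relabel_apply]
  refine hB _ _ ?_
  ext z
  simp only [Set.mem_inter_iff, Set.mem_image, Finset.mem_coe]
  have key : ∀ z ∈ F, (e.symm z ∈ ω ↔ e.symm z ∈ ω') := by
    intro z hz
    have hz' : e.symm z ∈ (↑(F.map e.symm.toEmbedding) : Set ι) := by
      rw [Finset.coe_map]; exact ⟨z, hz, rfl⟩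
    have := Set.ext_iff.1 h (e.symm z)
    simp only [Set.mem_inter_iff, hz', and_true] at this
    exact this
  constructor
  · rintro ⟨⟨x, hx, rfl⟩, hz⟩
    exact ⟨⟨x, by simpa using (key _ hz).1 (by simpa using hx), rfl⟩, hz⟩
  · rintro ⟨⟨x, hx, rfl⟩, hz⟩
    exact ⟨⟨x, by simpa using (key _ hz).2 (by simpa using hx), rfl⟩, hz⟩

/-- The `n`-th iterate of the pull-back: `((relabel e)^[n])⁻¹ B` is determined by `e^{-n}(F)`.
[cite: Grimmett2006, §4.3 (τ-invariance, p. 76)] -/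
theorem determinedBy_preimage_relabel_iterate {ι : Type*} (e : ι ≃ ι) {B : Set (Set ι)} {F : Finset ι}
    (hB : DeterminedBy B ↑F) (n : ℕ) :
    DeterminedBy ((SiteConfig.relabel e)^[n] ⁻¹' B) ↑(F.map (e.symm ^ n).toEmbedding) := by
  induction n generalizing B F with
  | zero => simpa using hB
  | succ n ih =>
    rw [Function.iterate_succ', Set.preimage_comp]
    have h := ih (determinedBy_preimage_relabel e hB) (F := F.map e.symm.toEmbedding)
    have hemb : (e.symm ^ (n + 1)).toEmbedding = e.symm.toEmbedding.trans (e.symm ^ n).toEmbedding := by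
      ext z
      simp [pow_succ, Equiv.Perm.mul_apply]
    rw [hemb, ← Finset.map_map]
    exact h

/-- Translates of a finite pair set along a non-zero translation eventually avoid the edges of any fixed box.
[cite: Grimmett2006, Cor. (4.23) (proof: |x| → ∞)] -/
theorem eventually_disjoint_map_shift_pow (F : Finset (Sym2 (Site d))) {v : Site d} (hv : v ≠ 0) (m : ℕ) :
    ∃ N : ℕ, ∀ n, N ≤ n →
      Disjoint (↑(F.map ((sym2Equiv (Site.shift v)).symm ^ n).toEmbedding) : Set (Sym2 (Site d)))
        ↑(edgesIn (zdGraph d) (box d m)) := by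
  obtain ⟨i, hi⟩ : ∃ i, v i ≠ 0 := by
    by_contra h
    push Not at h
    exact hv (funext h)
  refine ⟨m + F.sup pairRad + 1, fun n hn => ?_⟩
  rw [Finset.disjoint_coe, Finset.disjoint_left]
  intro z hz hzE
  obtain ⟨z₀, hz₀, rfl⟩ := Finset.mem_map.1 hz
  rw [mem_edgesIn_iff] at hzE
  -- the iterate of the inverse shift is the shift by `-n • v`
  have hiter : ∀ (k : ℕ) (x : Site d), ((Site.shift v).symm ^ k) x = x - (k : ℤ) • v := by
    intro k
    induction k with
    | zero => intro x; simp
    | succ k ih =>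
      intro x
      rw [pow_succ', Equiv.Perm.mul_apply, ih]
      simp only [Site.shift, Equiv.addRight_symm, Equiv.coe_addRight, Nat.cast_succ, add_smul, one_smul]
      abel
  have hsymm : ∀ k : ℕ, (sym2Equiv (Site.shift v)).symm ^ k = sym2Equiv ((Site.shift v).symm ^ k) := by
    intro k
    induction k with
    | zero => ext z; simp [sym2Equiv]
    | succ k ih =>
      rw [pow_succ, ih, pow_succ]
      ext z
      simp only [Equiv.Perm.mul_apply, sym2Equiv_symm, sym2Equiv_apply, Sym2.map_map]
      rfl
  induction z₀ using Sym2.ind with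
  | h x y =>
    have hx : x ∈ box d (F.sup pairRad) := by
      have := Finset.le_sup (f := pairRad) hz₀
      exact mem_box_of_pairRad_le this x (Sym2.mem_mk_left _ _)
    have hmem := hzE.2 (((Site.shift v).symm ^ n) x) (by
      rw [Equiv.coe_toEmbedding, hsymm n, sym2Equiv_apply, Sym2.map_mk]; exact Sym2.mem_mk_left _ _)
    rw [hiter, mem_box] at hmem
    rw [mem_box] at hx
    have h1 := (hmem i).1
    have h2 := (hmem i).2
    have hx1 := (hx i).1
    have hx2 := (hx i).2
    simp only [Pi.sub_apply, Pi.smul_apply, smul_eq_mul] at h1 h2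
    have hn' : (m : ℤ) + F.sup pairRad + 1 ≤ n := by exact_mod_cast hn
    rcases lt_or_gt_of_ne hi with hneg | hpos
    · have : (n : ℤ) * v i ≤ -n := by nlinarith
      linarith
    · have : (n : ℤ) ≤ n * v i := by nlinarith
      linarith

/-- **Mixing for increasing cylinders**: `P({E₀ open} ∩ τ_v^{-n} B) → P({E₀ open}) P(B)` for the box limit `P`
invariant under the translation by `v ≠ 0` and local `B`. [cite: Grimmett2006, Thm. (4.19)(d) and Cor. (4.23)] -/
theorem IsBoxLimit.tendsto_real_setOf_subset_inter_preimage_iterate (hP : IsBoxLimit d b p q P)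
    (hp : p ∈ Set.Icc (0 : ℝ) 1) (hq : 1 ≤ q) {v : Site d} (hv : v ≠ 0)
    (hinv : MeasurePreserving (BondConfig.relabel (sym2Equiv (Site.shift v))) P P)
    (E₀ : Finset (Sym2 (Site d))) {B : Set (BondConfig (Site d))} (hB : IsLocalEvent B) :
    Tendsto (fun n => P.real ({ω | (↑E₀ : Set (Sym2 (Site d))) ⊆ ω} ∩
        (BondConfig.relabel (sym2Equiv (Site.shift v)))^[n] ⁻¹' B)) atTop
      (𝓝 (P.real {ω | (↑E₀ : Set (Sym2 (Site d))) ⊆ ω} * P.real B)) := by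
  classical
  haveI := hP.isProbabilityMeasure
  set e := sym2Equiv (Site.shift v) with he
  set A : Set (BondConfig (Site d)) := {ω | (↑E₀ : Set (Sym2 (Site d))) ⊆ ω} with hAdef
  obtain ⟨F, hF⟩ := hB
  have hCn : ∀ n, P.real ((BondConfig.relabel e)^[n] ⁻¹' B) = P.real B := fun n =>
    congrArg ENNReal.toReal ((hinv.iterate n).measure_preimage
      (measurableSet_of_isLocalEvent_holds ⟨F, hF⟩).nullMeasurableSet)
  -- non-lattice `E₀`: both sides vanish
  by_cases hE : (↑E₀ : Set (Sym2 (Site d))) ⊆ (zdGraph d).edgeSet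
  swap
  · obtain ⟨e₀, he₀, he₀E⟩ := Set.not_subset.1 hE
    have hA0 : P.real A = 0 := by
      refine le_antisymm ?_ measureReal_nonneg
      have h0 : P.real {ω : BondConfig (Site d) | e₀ ∈ ω} = 0 := by
        rw [measureReal_eq_zero_iff]
        have hae := (hP.fkGibbs hp hq).ae_subset_edgeSet
        rw [ae_iff] at hae
        exact measure_mono_null (s := {ω : BondConfig (Site d) | e₀ ∈ ω})
          (fun ω (hω : e₀ ∈ ω) (hωE : ω ⊆ (zdGraph d).edgeSet) => he₀E (hωE hω)) hae
      rw [← h0]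
      exact measureReal_mono (fun ω hω => hω he₀)
    have h0n : ∀ n, P.real (A ∩ (BondConfig.relabel e)^[n] ⁻¹' B) = 0 := fun n =>
      le_antisymm ((measureReal_mono Set.inter_subset_left).trans hA0.le) measureReal_nonneg
    simp only [h0n, hA0, zero_mul]
    exact tendsto_const_nhds
  -- lattice `E₀`: the key estimate in the box `Λ_m`, `m → ∞`
  have hA : IsUpperSet A := fun ω ω' hle hω => Set.Subset.trans hω hle
  have hAm : ∀ m, E₀.sup pairRad ≤ m → DeterminedBy A ↑(edgesIn (zdGraph d) (box d m)) := by
    intro m hm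
    rw [determinedBy_iff]
    intro ω ω' h
    have hsub : (↑E₀ : Set (Sym2 (Site d))) ⊆ ↑(edgesIn (zdGraph d) (box d m)) := by
      intro z hz
      rw [Finset.mem_coe, mem_edgesIn_iff]
      exact ⟨hE hz, mem_box_of_pairRad_le ((Finset.le_sup (f := pairRad) hz).trans hm) ⟩
    simp only [hAdef, Set.mem_setOf_eq]
    constructor
    · intro hω z hz
      have := Set.ext_iff.1 h z
      simp only [Set.mem_inter_iff, hsub hz, and_true] at this
      exact this.1 (hω hz)
    · intro hω z hz
      have := Set.ext_iff.1 h z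
      simp only [Set.mem_inter_iff, hsub hz, and_true] at this
      exact this.2 (hω hz)
  have hAloc : IsLocalEvent A := ⟨_, hAm _ le_rfl⟩
  rw [Metric.tendsto_atTop]
  intro ε hε
  -- choose the box `Λ_m` with `|φ^b_{Λ_m}(A) - P(A)| < ε`
  have hlim := (hP.tendsto_rcBoxMeasure_real_preimage hAloc)
  rw [Metric.tendsto_atTop] at hlim
  obtain ⟨m₀, hm₀⟩ := hlim ε hε
  set m := max m₀ (E₀.sup pairRad) with hm
  obtain ⟨N, hN⟩ := eventually_disjoint_map_shift_pow F hv m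
  refine ⟨N, fun n hn => ?_⟩
  have hkey := hP.abs_real_inter_sub_mul_le hp hq m (F.map ((e.symm ^ n).toEmbedding)) hA
    (hAm m (le_max_right _ _)) (hN n hn) (determinedBy_preimage_relabel_iterate e hF n)
  rw [Real.dist_eq]
  have hCn' : P.real ((SiteConfig.relabel e)^[n] ⁻¹' B) = P.real B := hCn n
  rw [hCn'] at hkey
  refine hkey.trans_lt ?_
  have := hm₀ m (le_max_left _ _)
  rw [Real.dist_eq] at this
  rwa [← map_measureReal_apply (measurable_of_finite _) (measurableSet_of_isLocalEvent_holds hAloc), ← rcBoxLaw]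
    at this

/-- **Mixing on local events** (Grimmett 2006, Cor. (4.23)): for the box limit `P` invariant under the translation by
`v ≠ 0` and local `A`, `B`, `P(A ∩ τ_v^{-n} B) → P(A) P(B)` — from the increasing cylinders to all local `A` through
the conditional measures `P(· | τ_v^{-n} B)` (`exists_measure_tendsto_of_tendsto_supset`, `ext_of_setOf_subset`).
[cite: Grimmett2006, Cor. (4.23)] -/
theorem IsBoxLimit.tendsto_real_inter_preimage_iterate (hP : IsBoxLimit d b p q P)
    (hp : p ∈ Set.Icc (0 : ℝ) 1) (hq : 1 ≤ q) {v : Site d} (hv : v ≠ 0)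
    (hinv : MeasurePreserving (BondConfig.relabel (sym2Equiv (Site.shift v))) P P)
    {A B : Set (BondConfig (Site d))} (hA : IsLocalEvent A) (hB : IsLocalEvent B) :
    Tendsto (fun n => P.real (A ∩ (BondConfig.relabel (sym2Equiv (Site.shift v)))^[n] ⁻¹' B)) atTop
      (𝓝 (P.real A * P.real B)) := by
  classical
  haveI := hP.isProbabilityMeasure
  set e := sym2Equiv (Site.shift v) with he
  set C : ℕ → Set (BondConfig (Site d)) := fun n => (BondConfig.relabel e)^[n] ⁻¹' B with hCdef
  have hBmeas : MeasurableSet B := measurableSet_of_isLocalEvent_holds hB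
  have hAmeas : MeasurableSet A := measurableSet_of_isLocalEvent_holds hA
  have hCmeas : ∀ n, MeasurableSet (C n) := fun n =>
    hBmeas.preimage ((BondConfig.relabel e).measurable.iterate n)
  have hCB : ∀ n, P (C n) = P B := fun n => (hinv.iterate n).measure_preimage hBmeas.nullMeasurableSet
  have hCBr : ∀ n, P.real (C n) = P.real B := fun n => congrArg ENNReal.toReal (hCB n)
  change Tendsto (fun n => P.real (A ∩ C n)) atTop (𝓝 (P.real A * P.real B))
  by_cases hB0 : P B = 0
  · have h0 : ∀ n, P.real (A ∩ C n) = 0 := fun n =>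
      le_antisymm ((measureReal_mono Set.inter_subset_right).trans (by rw [hCBr n, measureReal_def, hB0]; simp))
        measureReal_nonneg
    have hB0r : P.real B = 0 := by rw [measureReal_def, hB0]; simp
    simp only [h0, hB0r, mul_zero]
    exact tendsto_const_nhds
  -- the conditional measures `P(· | C n)`
  have hC0 : ∀ n, P (C n) ≠ 0 := fun n => by rw [hCB n]; exact hB0
  set νs : ℕ → Measure (BondConfig (Site d)) := fun n => ProbabilityTheory.cond P (C n) with hνs
  haveI hνprob : ∀ n, IsProbabilityMeasure (νs n) := fun n => ProbabilityTheory.cond_isProbabilityMeasure (hC0 n)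
  have hBr0 : P.real B ≠ 0 := by
    rw [measureReal_def, ENNReal.toReal_ne_zero]; exact ⟨hB0, measure_ne_top P B⟩
  have hνapply : ∀ (n : ℕ) (X : Set (BondConfig (Site d))), MeasurableSet X →
      (νs n).real X = (P.real B)⁻¹ * P.real (X ∩ C n) := by
    intro n X hX
    rw [hνs]
    simp only
    rw [measureReal_def, ProbabilityTheory.cond_apply (hCmeas n), ENNReal.toReal_mul, ENNReal.toReal_inv,
      ← measureReal_def, ← measureReal_def, hCBr n, Set.inter_comm]
  -- increasing cylinders: `ν_n {E₀ ⊆ ω} → P {E₀ ⊆ ω}`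
  have hcyl : ∀ E₀ : Finset (Sym2 (Site d)),
      Tendsto (fun n => (νs n).real {ω | (↑E₀ : Set (Sym2 (Site d))) ⊆ ω}) atTop
        (𝓝 (P.real {ω | (↑E₀ : Set (Sym2 (Site d))) ⊆ ω})) := by
    intro E₀
    have h := (hP.tendsto_real_setOf_subset_inter_preimage_iterate hp hq hv hinv E₀ hB).const_mul (P.real B)⁻¹
    have heq : (P.real B)⁻¹ * (P.real {ω | (↑E₀ : Set (Sym2 (Site d))) ⊆ ω} * P.real B) =
        P.real {ω | (↑E₀ : Set (Sym2 (Site d))) ⊆ ω} := by field_simp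
    rw [heq] at h
    refine h.congr fun n => ?_
    rw [hνapply n _ (measurableSet_setOf_subset E₀)]
  obtain ⟨μ, hμ, hlim⟩ := exists_measure_tendsto_of_tendsto_supset νs fun E₀ => ⟨_, hcyl E₀⟩
  -- the limit is `P`
  have hμP : μ = P := by
    refine ext_of_setOf_subset fun E₀ => ?_
    have h1 := hlim _ (isLocalEvent_setOf_subset E₀)
    have h2 : Tendsto (fun n => νs n {ω | (↑E₀ : Set (Sym2 (Site d))) ⊆ ω}) atTop
        (𝓝 (P {ω | (↑E₀ : Set (Sym2 (Site d))) ⊆ ω})) := by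
      have h := ENNReal.tendsto_ofReal (hcyl E₀)
      rw [ofReal_measureReal] at h
      refine h.congr fun n => ?_
      rw [ofReal_measureReal]
    exact tendsto_nhds_unique h1 h2
  subst hμP
  -- conclude for the local event `A`
  have h3 : Tendsto (fun n => (νs n).real A) atTop (𝓝 (μ.real A)) :=
    ((ENNReal.tendsto_toReal (measure_ne_top μ A)).comp (hlim A hA)).congr fun n => rfl
  have h4 := h3.const_mul (μ.real B)
  refine h4.congr' (Filter.Eventually.of_forall fun n => ?_) |>.trans ?_
  · show μ.real B * (νs n).real A = μ.real (A ∩ C n)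
    rw [hνapply n A hAmeas, ← mul_assoc, mul_inv_cancel₀ hBr0, one_mul]
  · rw [mul_comm]

/-- **`φ^b_{p,q}` is ergodic under every non-zero translation** it is invariant under (Grimmett 2006, Cor. (4.23)):
mixing on local events and the tree's `ergodic_relabel_of_asymptotic_mixing_isLocalEvent`. [cite: Grimmett2006, Cor. (4.23)] -/
theorem IsBoxLimit.ergodic_shift (hP : IsBoxLimit d b p q P) (hp : p ∈ Set.Icc (0 : ℝ) 1) (hq : 1 ≤ q)
    {v : Site d} (hv : v ≠ 0) (hinv : MeasurePreserving (BondConfig.relabel (sym2Equiv (Site.shift v))) P P) :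
    Ergodic (BondConfig.relabel (sym2Equiv (Site.shift v))) P := by
  haveI := hP.isProbabilityMeasure
  refine ergodic_relabel_of_asymptotic_mixing_isLocalEvent (sym2Equiv (Site.shift v)) hinv fun B hB δ hδ => ?_
  have h := hP.tendsto_real_inter_preimage_iterate hp hq hv hinv hB hB
  rw [Metric.tendsto_atTop] at h
  obtain ⟨N, hN⟩ := h δ hδ
  refine ⟨N, ?_⟩
  have := hN N le_rfl
  rwa [Real.dist_eq] at this

/-- **Translation-invariant events are trivial under `φ^b_{p,q}`** (`d ≥ 1`; the `zero_one` field of the tree's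
`IsInsertionTolerantErgodic`), for a box limit invariant under all translations. [cite: Grimmett2006, Cor. (4.23)] -/
theorem IsBoxLimit.zero_one (hP : IsBoxLimit d b p q P) (hp : p ∈ Set.Icc (0 : ℝ) 1) (hq : 1 ≤ q) (hd : 0 < d)
    (hinv : ∀ v : Site d, MeasurePreserving (BondConfig.relabel (sym2Equiv (Site.shift v))) P P)
    {S : Set (BondConfig (Site d))} (hS : MeasurableSet S)
    (hSinv : ∀ v : Site d, BondConfig.relabel (sym2Equiv (Site.shift v)) ⁻¹' S = S) : P S = 0 ∨ P S = 1 := by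
  haveI := hP.isProbabilityMeasure
  set v : Site d := Pi.single ⟨0, hd⟩ 1 with hv
  have hv0 : v ≠ 0 := by
    intro h
    have := congrFun h ⟨0, hd⟩
    simp [hv] at this
  exact (hP.ergodic_shift hp hq hv0 (hinv v)).toPreErgodic.prob_eq_zero_or_one hS (hSinv v)

/-- **Unconditional form**: every box limit `φ^b_{p,q}` (`p ∈ [0,1]`, `q ≥ 1`) is ergodic under every non-zero
translation (invariance from the cell's `IsBoxLimit.measurePreserving_relabel_shift`). [cite: Grimmett2006, Cor. (4.23)] -/
theorem IsBoxLimit.ergodic_shift' (hP : IsBoxLimit d b p q P) (hp : p ∈ Set.Icc (0 : ℝ) 1) (hq : 1 ≤ q)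
    {v : Site d} (hv : v ≠ 0) : Ergodic (BondConfig.relabel (sym2Equiv (Site.shift v))) P :=
  hP.ergodic_shift hp hq hv (hP.measurePreserving_relabel_shift hp hq v)

/-- **Unconditional form** of `zero_one`: translation-invariant events are trivial under every box limit (`d ≥ 1`).
[cite: Grimmett2006, Cor. (4.23)] -/
theorem IsBoxLimit.zero_one' (hP : IsBoxLimit d b p q P) (hp : p ∈ Set.Icc (0 : ℝ) 1) (hq : 1 ≤ q) (hd : 0 < d)
    {S : Set (BondConfig (Site d))} (hS : MeasurableSet S)
    (hSinv : ∀ v : Site d, BondConfig.relabel (sym2Equiv (Site.shift v)) ⁻¹' S = S) : P S = 0 ∨ P S = 1 :=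
  hP.zero_one hp hq hd (fun v => hP.measurePreserving_relabel_shift hp hq v) hS hSinv

/-- The cell's `rcLimit d b p q` is ergodic under every non-zero translation. [cite: Grimmett2006, Cor. (4.23)] -/
theorem ergodic_shift_rcLimit (b : Bool) (hp : p ∈ Set.Icc (0 : ℝ) 1) (hq : 1 ≤ q) {v : Site d} (hv : v ≠ 0) :
    Ergodic (BondConfig.relabel (sym2Equiv (Site.shift v))) (rcLimit d b p q) :=
  (isBoxLimit_rcLimit b hp hq).ergodic_shift' hp hq hv

end Ergodic

end Summit.CriticalPhenomena.PercolationContinuityZ3.Theorems.FK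

end
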